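import Literature.Geometry.Kaehler.ComplexTorusCycleClassPairing
import Literature.Geometry.Kaehler.ComplexTorusLefschetzAlgebraCorrespondencesAnyBasis
import Literature.Geometry.Kaehler.ComplexTorusIntegralLefschetzFormDegreeOneDualType
import Literature.Geometry.Kaehler.ComplexTorusHardLefschetzMinimalClassModPrimeImage
import HarnessLib

/-!
# The cup-product pairing `⟨γ, δ⟩_e = (γ ∧ δ)(λ_{e 0}, …, λ_{e (n−1)})` depends on the presentation of the torus only
# through a sign `±1`; `IsPolarizationType` forms of the pairing statements proved on symplectic presentations

Layer `Literature/Geometry/Kaehler`, namespace `Literature.Geometry.Kaehler.ComplexTorus`; lane `lit-hodgefound` (Track 2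
foundations library), seat p09, generation 42, row g42-#1 (successor-menu item (a) of generation 41). THEOREMS ONLY (0 definitions);
no named fact, net debt 0.

THE POINT. The tree presents a complex torus `X = E/Λ` by a real isomorphism `Φ : ℝ^ι ≃ E` (a `ℤ`-basis `λ_a = Φ(e_a)` of `Λ`) and
defines the Poincaré (cup-product) pairing `poincarePairing Φ e h : Hᵏ(X, ℂ) × Hˡ(X, ℂ) → ℂ` (`k + l = n = rk Λ`) by evaluating
`γ ∧ δ` on the ORDERED LATTICE BASIS `(λ_{e 0}, …, λ_{e (n−1)})` of an orientation datum `e : Fin n ≃ ι`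
(`ComplexTorusPoincareDuality`; Lange 2023, §6.2.4 p. 310: "the cup product pairing `Hᵖ(X, ℤ) ⊗ H^{2g−p}(X, ℤ) → H^{2g}(X, ℤ) ≃ ℤ`",
the last isomorphism `d` being evaluation on the fundamental class). A second presentation `Φ' : ℝ^{ι'} ≃ E` WITH THE SAME LATTICE
(`range (latticeVec Φ') = range (latticeVec Φ)`) has another `ℤ`-basis of `Λ`, so its ordered basis differs from that of `Φ` by a
unimodular integer matrix, and a top-degree form takes on it `det = ±1` times its value on the first:

  **`⟨γ, δ⟩_{Φ', e'} = ε · ⟨γ, δ⟩_{Φ, e}`, `ε = sign_X(Φ', e') · sign_X(Φ, e) ∈ {±1}`** (§1),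

where `sign_X(Φ, e) = orientationSign Φ e` compares the `e`-ordered lattice basis with the complex orientation of `X`
(`ComplexTorusSubtorusCycleClass`: `∫_X θ = sign_X(Φ, e) · θ(λ_{e 0}, …)`; `∫_X` itself is presentation-free,
`torusIntegral_eq_of_range_latticeVec_eq` of `ComplexTorusLefschetzAlgebraCorrespondencesAnyBasis`). Consequently everything
about the pairing that is insensitive to a global sign is presentation-free (§1: vanishing, kernels, pre-images of subgroups of `ℂ`,
images of subgroups, `|det|` of Gram matrices), and the statements of generations 40–41 that were proved for a torus presented ON A
SYMPLECTIC BASIS (`IsSymplecticEnum Φ e₀ η d`) and mention the pairing of that presentation hold for EVERY presentation of a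
polarised torus of type `(d₁, …, d_g)` (`IsPolarizationType Φ η d`; every such torus admits a symplectic presentation with the same
lattice, `IsPolarizationType.exists_isSymplecticEnum`):

* §2 (from g41-#6 `ComplexTorusIntegralLefschetzFormDegreeOneDualType`) **the integral Lefschetz form `(x, y) ↦ ⟨x, γ_{g−1} ∧ y⟩` on
  `H¹(X, ℤ)` of ANY polarised torus of type `(d₁, …, d_g)` has a symplectic `ℤ`-basis with Gram matrix `( 0 Δ' ; −Δ' 0 )`,
  `Δ' = diag(d_g/d_{g+1−i})`** — the reduced dual type `(1, d_g/d_{g−1}, …, d_g/d₁)` (Lange 2023, Prop. 2.5.1, Exercise 2.5.4 (6)(a)),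
  in every presentation and every orientation (a sign `ε = −1` is absorbed by negating the `λ`-half of the basis);
* §3 (from g41-#2/#3 `ComplexTorusHardLefschetzMinimalClassModPrime{Kernel,Image}`) for a constant type (`d₁ = ⋯ = d_g`, e.g. a
  principal polarisation), `g = j + 2`: `γ_{g−2} ∧ θ/d₁ = (g−1)·γ_{g−1}`, `⟨θ/d₁, γ_{g−2} ∧ x⟩ = (g−1)·⟨x, γ_{g−1}⟩`, and for a prime
  `p ∣ g − 1` **the image of `γ_{g−2} ∪ (−)` on `H²(X, ℤ/p)` is the annihilator of the polarisation**,
  `γ_{g−2} ∧ H²(X, ℤ) + p·H^{2g−2}(X, ℤ) = {z ∈ H^{2g−2}(X, ℤ) : p ∣ ⟨θ/d₁, z⟩}`, in every presentation.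

Sources (the statements are the tree's readings over `ℤ` of): Lange 2023 §6.2.4 (PDF p. 310 L9–L13: the cup product pairing and
Poincaré duality over `ℤ`; proof of Prop. 6.2.20: the map `d : H^{2g}(X, ℤ) ⥲ ℤ`), §1.1.2 (PDF p. 18: "the period matrix … depends on the
choice of the bases for `V` and `Λ`"), §1.7.2 Cor. 1.7.6 (the transformation formula for `∫_X`), §1.5.1 (PDF p. 51: symplectic bases and
types), §2.5.1 Prop. 2.5.1 (PDF p. 129: the dual polarisation), §2.5.3 Thm. 2.5.16 / Cor. 2.5.17 (PDF p. 135), §5.4.1 (5.22) (PDF p. 275);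
Voisin 2002 §7.1.2 (PDF p. 134 L31: `L` acts on integral cohomology), §5.2.2 (Poincaré duality by cup product and `∫_X`).

## Contents (theorems only)

* §1 `poincarePairing_eq_orientationSign_mul_of_range_latticeVec_eq` (the sign formula), `exists_units_poincarePairing_eq_mul_…`
  (`∃ ε : ℤˣ`), `poincarePairing_rebase` (the tree's `rebase Φ b`); sign-free consequences `poincarePairing_eq_zero_iff_…`,
  `ker_poincarePairing_eq_…`, `comap_poincarePairing_eq_…`, `map_poincarePairing_eq_…`, `natAbs_det_eq_of_eq_poincarePairing_…`.
* §2 `IsPolarizationType.exists_basis_poincarePairing_wedge_eq_fromBlocks_rev_of_eq_content_smul`,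
  `IsPolarizationType.exists_minimalClass_basis_poincarePairing_wedge_eq_fromBlocks_rev`.
* §3 `IsPolarizationType.wedge_inv_smul_ofRealForm_eq_nsmul_of_forall_eq`, `IsPolarizationType.poincarePairing_inv_smul_ofRealForm_wedge_of_forall_eq`,
  `IsPolarizationType.map_wedge_integralForms_two_sup_map_nsmul_eq_inf_comap_of_forall_eq` (+ membership and existence forms).

## References

* [cite: Lange2023AbelianVarietiesComplex, §6.2.4 (PDF p. 310 L9–L13) and proof of Prop. 6.2.20; §1.1.2 (PDF p. 18); §1.7.2 Cor. 1.7.6; §1.5.1 (PDF p. 51); §2.5.1 Prop. 2.5.1 (PDF p. 129); §2.5.3 Thm. 2.5.16, Cor. 2.5.17 (PDF p. 135); §5.4.1 (5.22) (PDF p. 275)]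
* [cite: VoisinHodgeI2002, §5.2.2; §7.1.2 (PDF p. 134 L31); §7.2.2 (PDF p. 142 L10)]
* [cite: BenoistDebarre2023SmoothSubvarietiesJacobians, §1 (p. 3)]
-/

noncomputable section

open Module Function
open Literature.LinearAlgebra.Alternating

namespace Literature.Geometry.Kaehler.ComplexTorus

/-! ## §1 The pairing of two presentations with the same lattice differ by a sign -/

section AnyBasis

variable {ι ι' : Type*} [Fintype ι] [Fintype ι'] [DecidableEq ι] [DecidableEq ι']
  {E : Type*} [NormedAddCommGroup E] [NormedSpace ℂ E]
  (Φ : (ι → ℝ) ≃L[ℝ] E) (Φ' : (ι' → ℝ) ≃L[ℝ] E) {n k l : ℕ}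

/-- **The cup-product pairing depends on the presentation only through a sign**: for two presentations `Φ`, `Φ'` of `X = E/Λ` with the
same lattice and orientation data `e`, `e'`, `⟨γ, δ⟩_{Φ', e'} = sign_X(Φ', e')·sign_X(Φ, e) · ⟨γ, δ⟩_{Φ, e}` (both pairings are `±∫_X γ ∧ δ`,
and `∫_X` is presentation-free). [cite: Lange2023AbelianVarietiesComplex, §6.2.4 (PDF p. 310 L9–L13) and §1.7.2 Cor. 1.7.6] -/
theorem poincarePairing_eq_orientationSign_mul_of_range_latticeVec_eq (hr : Set.range (latticeVec Φ') = Set.range (latticeVec Φ))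
    (e : Fin n ≃ ι) (e' : Fin n ≃ ι') (h : k + l = n) (γ : E [⋀^Fin k]→L[ℝ] ℂ) (δ : E [⋀^Fin l]→L[ℝ] ℂ) :
    poincarePairing Φ' e' h γ δ =
      ((orientationSign Φ' ((finCongr h).trans e') * orientationSign Φ ((finCongr h).trans e) : ℤ) : ℂ) * poincarePairing Φ e h γ δ := by
  rw [poincarePairing_eq_orientationSign_mul_torusIntegral_wedge Φ' e' h, poincarePairing_eq_orientationSign_mul_torusIntegral_wedge Φ e h,
    torusIntegral_eq_of_range_latticeVec_eq Φ Φ' hr ((finCongr h).trans e) ((finCongr h).trans e'), Int.cast_mul, mul_assoc,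
    ← mul_assoc ((orientationSign Φ ((finCongr h).trans e) : ℤ) : ℂ), ← Int.cast_mul, orientationSign_mul_self, Int.cast_one, one_mul]

omit [Fintype ι] [Fintype ι'] in
/-- The sign relating the pairings of two presentations with the same lattice is `±1`.
[cite: Lange2023AbelianVarietiesComplex, §6.2.4 (PDF p. 310 L9–L13)] -/
theorem orientationSign_mul_orientationSign_eq_one_or (e : Fin n → ι) (e' : Fin n → ι') :
    orientationSign Φ' e' * orientationSign Φ e = 1 ∨ orientationSign Φ' e' * orientationSign Φ e = -1 := by
  rcases orientationSign_eq_or Φ' e' with h' | h' <;> rcases orientationSign_eq_or Φ e with h | h <;> simp [h, h']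

/-- **`⟨γ, δ⟩_{Φ', e'} = ε · ⟨γ, δ⟩_{Φ, e}` for a unit `ε = ±1 ∈ ℤˣ`** (two presentations with the same lattice).
[cite: Lange2023AbelianVarietiesComplex, §6.2.4 (PDF p. 310 L9–L13) and §1.1.2 (PDF p. 18)] -/
theorem exists_units_poincarePairing_eq_mul_of_range_latticeVec_eq (hr : Set.range (latticeVec Φ') = Set.range (latticeVec Φ))
    (e : Fin n ≃ ι) (e' : Fin n ≃ ι') (h : k + l = n) :
    ∃ ε : ℤˣ, ∀ (γ : E [⋀^Fin k]→L[ℝ] ℂ) (δ : E [⋀^Fin l]→L[ℝ] ℂ),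
      poincarePairing Φ' e' h γ δ = ((ε : ℤ) : ℂ) * poincarePairing Φ e h γ δ := by
  obtain ⟨s, hs1, hs⟩ : ∃ s : ℤ, s * s = 1 ∧ ∀ (γ : E [⋀^Fin k]→L[ℝ] ℂ) (δ : E [⋀^Fin l]→L[ℝ] ℂ),
      poincarePairing Φ' e' h γ δ = (s : ℂ) * poincarePairing Φ e h γ δ :=
    ⟨_, by
      rcases orientationSign_mul_orientationSign_eq_one_or Φ Φ' ((finCongr h).trans e) ((finCongr h).trans e') with h1 | h1 <;>
        rw [h1] <;> norm_num,
      poincarePairing_eq_orientationSign_mul_of_range_latticeVec_eq Φ Φ' hr e e' h⟩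
  exact ⟨Units.mkOfMulEqOne s s hs1, fun γ δ ↦ by rw [Units.val_mkOfMulEqOne]; exact hs γ δ⟩

/-- **Re-presenting on another `ℤ`-basis `b` of the lattice** (the tree's `rebase Φ b`): `⟨γ, δ⟩_{rebase Φ b, e'} = ±⟨γ, δ⟩_{Φ, e}`.
[cite: Lange2023AbelianVarietiesComplex, §1.1.2 (PDF p. 18) and §6.2.4 (PDF p. 310 L9–L13)] -/
theorem poincarePairing_rebase (b : Module.Basis ι' ℤ (ι → ℤ)) (e : Fin n ≃ ι) (e' : Fin n ≃ ι') (h : k + l = n)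
    (γ : E [⋀^Fin k]→L[ℝ] ℂ) (δ : E [⋀^Fin l]→L[ℝ] ℂ) :
    poincarePairing (rebase Φ b) e' h γ δ =
      ((orientationSign (rebase Φ b) ((finCongr h).trans e') * orientationSign Φ ((finCongr h).trans e) : ℤ) : ℂ) *
        poincarePairing Φ e h γ δ :=
  poincarePairing_eq_orientationSign_mul_of_range_latticeVec_eq Φ (rebase Φ b) (range_latticeVec_rebase Φ b) e e' h γ δ

/-- Same presentation, two orientations: `⟨γ, δ⟩_{e'} = sign_X(e')·sign_X(e) · ⟨γ, δ⟩_e` (compare `poincarePairing_perm_trans`: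
the factor is `sign (e⁻¹ e')`). [cite: Lange2023AbelianVarietiesComplex, §6.2.4 proof of Prop. 6.2.20 (PDF p. 310)] -/
theorem poincarePairing_eq_orientationSign_mul_poincarePairing (e e' : Fin n ≃ ι) (h : k + l = n) (γ : E [⋀^Fin k]→L[ℝ] ℂ)
    (δ : E [⋀^Fin l]→L[ℝ] ℂ) :
    poincarePairing Φ e' h γ δ =
      ((orientationSign Φ ((finCongr h).trans e') * orientationSign Φ ((finCongr h).trans e) : ℤ) : ℂ) * poincarePairing Φ e h γ δ :=
  poincarePairing_eq_orientationSign_mul_of_range_latticeVec_eq Φ Φ rfl e e' h γ δ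

/-- Vanishing of a pairing is presentation-free. [cite: Lange2023AbelianVarietiesComplex, §6.2.4 (PDF p. 310 L9–L13)] -/
theorem poincarePairing_eq_zero_iff_of_range_latticeVec_eq (hr : Set.range (latticeVec Φ') = Set.range (latticeVec Φ))
    (e : Fin n ≃ ι) (e' : Fin n ≃ ι') (h : k + l = n) (γ : E [⋀^Fin k]→L[ℝ] ℂ) (δ : E [⋀^Fin l]→L[ℝ] ℂ) :
    poincarePairing Φ' e' h γ δ = 0 ↔ poincarePairing Φ e h γ δ = 0 := by
  obtain ⟨ε, hε⟩ := exists_units_poincarePairing_eq_mul_of_range_latticeVec_eq Φ Φ' hr e e' h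
  rw [hε, mul_eq_zero, or_iff_right]
  exact_mod_cast ε.ne_zero

/-- The kernel of `⟨γ, ·⟩` is presentation-free. [cite: Lange2023AbelianVarietiesComplex, §6.2.4 (PDF p. 310 L9–L13)] -/
theorem ker_poincarePairing_eq_of_range_latticeVec_eq (hr : Set.range (latticeVec Φ') = Set.range (latticeVec Φ))
    (e : Fin n ≃ ι) (e' : Fin n ≃ ι') (h : k + l = n) (γ : E [⋀^Fin k]→L[ℝ] ℂ) :
    LinearMap.ker (poincarePairing Φ' e' h γ) = LinearMap.ker (poincarePairing Φ e h γ) := by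
  ext δ
  rw [LinearMap.mem_ker, LinearMap.mem_ker]
  exact poincarePairing_eq_zero_iff_of_range_latticeVec_eq Φ Φ' hr e e' h γ δ

/-- The pre-image under `⟨γ, ·⟩` of a subgroup of `ℂ` (e.g. `p·ℤ`: "`p ∣ ⟨γ, δ⟩`") is presentation-free (a subgroup is stable under `±1`).
[cite: Lange2023AbelianVarietiesComplex, §6.2.4 (PDF p. 310 L9–L13)] -/
theorem comap_poincarePairing_eq_of_range_latticeVec_eq (hr : Set.range (latticeVec Φ') = Set.range (latticeVec Φ))
    (e : Fin n ≃ ι) (e' : Fin n ≃ ι') (h : k + l = n) (γ : E [⋀^Fin k]→L[ℝ] ℂ) (S : AddSubgroup ℂ) :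
    S.comap (poincarePairing Φ' e' h γ).toAddMonoidHom = S.comap (poincarePairing Φ e h γ).toAddMonoidHom := by
  obtain ⟨ε, hε⟩ := exists_units_poincarePairing_eq_mul_of_range_latticeVec_eq Φ Φ' hr e e' h
  ext δ
  rw [AddSubgroup.mem_comap, AddSubgroup.mem_comap, LinearMap.toAddMonoidHom_coe, LinearMap.toAddMonoidHom_coe, hε]
  rcases Int.units_eq_one_or ε with h1 | h1
  · rw [h1, Units.val_one, Int.cast_one, one_mul]
  · rw [h1, Units.val_neg, Units.val_one, Int.cast_neg, Int.cast_one, neg_one_mul, neg_mem_iff]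

/-- The image `⟨γ, S⟩` of a subgroup `S` (e.g. `⟨γ, Hˡ(X, ℤ)⟩`, the value group) is presentation-free.
[cite: Lange2023AbelianVarietiesComplex, §6.2.4 (PDF p. 310 L9–L13)] -/
theorem map_poincarePairing_eq_of_range_latticeVec_eq (hr : Set.range (latticeVec Φ') = Set.range (latticeVec Φ))
    (e : Fin n ≃ ι) (e' : Fin n ≃ ι') (h : k + l = n) (γ : E [⋀^Fin k]→L[ℝ] ℂ) (S : AddSubgroup (E [⋀^Fin l]→L[ℝ] ℂ)) :
    S.map (poincarePairing Φ' e' h γ).toAddMonoidHom = S.map (poincarePairing Φ e h γ).toAddMonoidHom := by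
  obtain ⟨ε, hε⟩ := exists_units_poincarePairing_eq_mul_of_range_latticeVec_eq Φ Φ' hr e e' h
  ext z
  rw [AddSubgroup.mem_map, AddSubgroup.mem_map]
  rcases Int.units_eq_one_or ε with h1 | h1
  · simp only [LinearMap.toAddMonoidHom_coe, hε, h1, Units.val_one, Int.cast_one, one_mul]
  · simp only [LinearMap.toAddMonoidHom_coe, hε, h1, Units.val_neg, Units.val_one, Int.cast_neg, Int.cast_one, neg_one_mul]
    constructor
    · rintro ⟨δ, hδ, rfl⟩
      exact ⟨-δ, S.neg_mem hδ, by rw [map_neg]⟩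
    · rintro ⟨δ, hδ, rfl⟩
      exact ⟨-δ, S.neg_mem hδ, by rw [map_neg, neg_neg]⟩

/-- **Gram matrices of the two presentations differ by the sign `ε`, so `|det|` is presentation-free**: if `G`, `G'` are integer matrices
with `G_{ij} = ⟨b_i, c_j⟩_{Φ, e}`, `G'_{ij} = ⟨b_i, c_j⟩_{Φ', e'}`, then `|det G'| = |det G|`.
[cite: Lange2023AbelianVarietiesComplex, §6.2.4 (PDF p. 310 L9–L13)] -/
theorem natAbs_det_eq_of_eq_poincarePairing_of_range_latticeVec_eq (hr : Set.range (latticeVec Φ') = Set.range (latticeVec Φ))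
    (e : Fin n ≃ ι) (e' : Fin n ≃ ι') (h : k + l = n) {m : Type*} [Fintype m] [DecidableEq m] (b : m → E [⋀^Fin k]→L[ℝ] ℂ)
    (c : m → E [⋀^Fin l]→L[ℝ] ℂ) (G G' : Matrix m m ℤ) (hG : ∀ i j, (G i j : ℂ) = poincarePairing Φ e h (b i) (c j))
    (hG' : ∀ i j, (G' i j : ℂ) = poincarePairing Φ' e' h (b i) (c j)) :
    G'.det.natAbs = G.det.natAbs := by
  obtain ⟨ε, hε⟩ := exists_units_poincarePairing_eq_mul_of_range_latticeVec_eq Φ Φ' hr e e' h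
  have hGG : G' = (ε : ℤ) • G := by
    ext i j
    apply Int.cast_injective (α := ℂ)
    rw [hG', Matrix.smul_apply, smul_eq_mul, Int.cast_mul, hG, hε]
  rw [hGG, Matrix.det_smul, Int.natAbs_mul, Int.natAbs_pow]
  rcases Int.units_eq_one_or ε with h1 | h1 <;> simp [h1]

end AnyBasis

/-! ## §2 The H¹ Lefschetz form of ANY polarised torus of type `(d₁, …, d_g)` is symplectic of the reduced dual type -/

section DegreeOne

variable {ι : Type*} [Fintype ι] [DecidableEq ι] {E : Type*} [NormedAddCommGroup E] [NormedSpace ℂ E]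
  {Φ : (ι → ℝ) ≃L[ℝ] E} {j n : ℕ} {η : E [⋀^Fin 2]→L[ℝ] ℝ} {d : Fin (j + 1) → ℕ}

/-- **The integral Lefschetz form `(x, y) ↦ ⟨x, m ∧ y⟩` of the minimal class `m = γ_{g−1}` (`θ^{∧(g−1)} = ((g−1)!·d₁⋯d_{g−1})·m`) on
`H¹(X, ℤ)` of ANY polarised complex torus of type `(d₁, …, d_g)` — any presentation `Φ`, any orientation `e` — is a symplectic lattice of
type `(1, d_g/d_{g−1}, …, d_g/d₁)`**, the reduced type of the dual polarisation: there is a `ℤ`-basis of `H¹(X, ℤ)` with Gram matrix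
`( 0 Δ' ; −Δ' 0 )`, `Δ' = diag(d_g/d_{g+1−i})`, `δ'₁ = 1`, `δ'_i ∣ δ'_{i+1}` (`g = j + 1`). (Symplectic presentation: g41-#6; the pairing
of `Φ` is `±` that one, and `−1` is absorbed by negating the first half of the basis.)
[cite: Lange2023AbelianVarietiesComplex, §2.5.1 Prop. 2.5.1 (PDF p. 129); §2.5.4 Exercise (6)(a) (PDF p. 136); §2.5.3 Cor. 2.5.17 (c) (PDF p. 135); §1.5.1 (PDF p. 51); §6.2.4 (PDF p. 310)] [cite: VoisinHodgeI2002, §7.1.2 (PDF p. 134 L31); §7.2.2 (PDF p. 142 L10)] -/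
theorem IsPolarizationType.exists_basis_poincarePairing_wedge_eq_fromBlocks_rev_of_eq_content_smul (hd : IsPolarizationType Φ η d)
    (hη : IsRiemannForm Φ η) (e : Fin n ≃ ι) (hn : 1 + (2 * j + 1) = n) (hle : j ≤ j + 1) {m : E [⋀^Fin (2 * j)]→L[ℝ] ℂ}
    (hm : wedgePow (ofRealForm η) j = ((j.factorial * ∏ i : Fin j, d (Fin.castLE hle i) : ℕ) : ℂ) • m) :
    (d (Fin.last j) / d (Fin.rev 0) = 1 ∧
      ∀ i i' : Fin (j + 1), i ≤ i' → d (Fin.last j) / d (Fin.rev i) ∣ d (Fin.last j) / d (Fin.rev i')) ∧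
    ∃ b : Basis (Fin (j + 1) ⊕ Fin (j + 1)) ℤ ↥(integralForms Φ 1), ∀ x y,
      poincarePairing Φ e hn (b x : E [⋀^Fin 1]→L[ℝ] ℂ) (m.wedge (b y : E [⋀^Fin 1]→L[ℝ] ℂ)) =
        ((Matrix.fromBlocks 0 (Matrix.diagonal fun i ↦ ((d (Fin.last j) / d (Fin.rev i) : ℕ) : ℤ))
          (-Matrix.diagonal fun i ↦ ((d (Fin.last j) / d (Fin.rev i) : ℕ) : ℤ)) 0) x y : ℂ) := by
  obtain ⟨Φ', hΛ, hs⟩ := hd.exists_isSymplecticEnum Φ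
  have hη' : IsRiemannForm Φ' η := hη.of_range_latticeVec_subset hΛ.le
  have hn' : n = 2 * (j + 1) := by omega
  set e' : Fin n ≃ Fin (j + 1) ⊕ Fin (j + 1) := (finCongr hn').trans (ilvEnum (Equiv.refl _)) with he'
  obtain ⟨hdiv, b, hb⟩ := hs.exists_basis_poincarePairing_wedge_eq_fromBlocks_rev_of_eq_content_smul Φ' hη' e' hn hle hm
  refine ⟨hdiv, ?_⟩
  -- the sign relating the two pairings
  obtain ⟨ε, hε⟩ := exists_units_poincarePairing_eq_mul_of_range_latticeVec_eq Φ' Φ hΛ.symm e' e hn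
  have hεε : ((ε : ℤ) : ℂ) * ((ε : ℤ) : ℂ) = 1 := by
    rw [← Int.cast_mul, ← Units.val_mul, Int.units_mul_self, Units.val_one, Int.cast_one]
  -- transport the basis to `H¹(X, ℤ)` of `Φ` (the same subgroup) and absorb the sign into the `λ`-half
  have hS : integralForms Φ' 1 = integralForms Φ 1 := integralForms_eq_of_range_latticeVec_eq hΛ 1
  let u : Fin (j + 1) ⊕ Fin (j + 1) → ℤˣ := fun x ↦ Sum.elim (fun _ ↦ ε) (fun _ ↦ 1) x
  let b₁ : Basis (Fin (j + 1) ⊕ Fin (j + 1)) ℤ ↥(integralForms Φ 1) :=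
    (b.map (AddEquiv.addSubgroupCongr hS).toIntLinearEquiv).unitsSMul u
  have hb₁ : ∀ x, (b₁ x : E [⋀^Fin 1]→L[ℝ] ℂ) = ((u x : ℤ) : ℂ) • (b x : E [⋀^Fin 1]→L[ℝ] ℂ) := fun x ↦ by
    change (((b.map (AddEquiv.addSubgroupCongr hS).toIntLinearEquiv).unitsSMul u x : ↥(integralForms Φ 1)) :
      E [⋀^Fin 1]→L[ℝ] ℂ) = _
    rw [Basis.unitsSMul_apply, Units.smul_def, AddSubgroup.coe_zsmul, Basis.map_apply, AddEquiv.coe_toIntLinearEquiv,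
      AddEquiv.addSubgroupCongr_apply]
    exact (Int.cast_smul_eq_zsmul ℂ _ _).symm
  refine ⟨b₁, fun x y ↦ ?_⟩
  rw [hb₁, hb₁, wedge_smul_right_complex, map_smul, map_smul, LinearMap.smul_apply, smul_eq_mul, smul_eq_mul, hε, hb]
  have hul : ∀ a, ((u (Sum.inl a) : ℤ) : ℂ) = ε := fun a ↦ rfl
  have hur : ∀ c, ((u (Sum.inr c) : ℤ) : ℂ) = 1 := fun c ↦ by simp [u]
  rcases x with a | a <;> rcases y with c | c
  · rw [Matrix.fromBlocks_apply₁₁, Matrix.zero_apply, Int.cast_zero, mul_zero, mul_zero, mul_zero]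
  · rw [hul, hur, Matrix.fromBlocks_apply₁₂, one_mul, ← mul_assoc, hεε, one_mul]
  · rw [hul, hur, Matrix.fromBlocks_apply₂₁, one_mul, ← mul_assoc, hεε, one_mul]
  · rw [Matrix.fromBlocks_apply₂₂, Matrix.zero_apply, Int.cast_zero, mul_zero, mul_zero, mul_zero]

/-- **Existence form: every polarised complex torus of type `(d₁, …, d_g)` carries the integral minimal class `γ_{g−1} ∈ H^{2g−2}(X, ℤ)`, and
its Lefschetz form on `H¹(X, ℤ)` is a symplectic lattice with elementary divisors `d_g/d_{g+1−i}`** — any presentation, any orientation.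
[cite: Lange2023AbelianVarietiesComplex, §2.5.1 Prop. 2.5.1 (PDF p. 129); §2.5.3 Thm. 2.5.16 and Cor. 2.5.17 (c) (PDF p. 135); §6.2.4 (PDF p. 310)] [cite: VoisinHodgeI2002, §7.2.2 (PDF p. 142 L10)] -/
theorem IsPolarizationType.exists_minimalClass_basis_poincarePairing_wedge_eq_fromBlocks_rev (hd : IsPolarizationType Φ η d)
    (hη : IsRiemannForm Φ η) (e : Fin n ≃ ι) (hn : 1 + (2 * j + 1) = n) (hle : j ≤ j + 1) :
    ∃ m ∈ integralForms Φ (2 * j), wedgePow (ofRealForm η) j = ((j.factorial * ∏ i : Fin j, d (Fin.castLE hle i) : ℕ) : ℂ) • m ∧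
      ∃ b : Basis (Fin (j + 1) ⊕ Fin (j + 1)) ℤ ↥(integralForms Φ 1), ∀ x y,
        poincarePairing Φ e hn (b x : E [⋀^Fin 1]→L[ℝ] ℂ) (m.wedge (b y : E [⋀^Fin 1]→L[ℝ] ℂ)) =
          ((Matrix.fromBlocks 0 (Matrix.diagonal fun i ↦ ((d (Fin.last j) / d (Fin.rev i) : ℕ) : ℤ))
            (-Matrix.diagonal fun i ↦ ((d (Fin.last j) / d (Fin.rev i) : ℕ) : ℤ)) 0) x y : ℂ) := by
  obtain ⟨m, hmZ, hm⟩ := hd.exists_mem_integralForms_wedgePow_eq_content_smul hle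
  exact ⟨m, hmZ, hm, (hd.exists_basis_poincarePairing_wedge_eq_fromBlocks_rev_of_eq_content_smul hη e hn hle hm).2⟩

end DegreeOne

/-! ## §3 Constant type, `p ∣ g − 1`: the image of `γ_{g−2} ∪ (−)` modulo `p` is the annihilator of the polarisation — any presentation -/

section ModPrimeImage

variable {ι : Type*} [Fintype ι] [DecidableEq ι] {E : Type*} [NormedAddCommGroup E] [NormedSpace ℂ E]
  {Φ : (ι → ℝ) ≃L[ℝ] E} {j n : ℕ} {η : E [⋀^Fin 2]→L[ℝ] ℝ} {d : Fin (j + 2) → ℕ}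

/-- **`γ_{g−2} ∧ (θ/d₁) = (g−1) · γ_{g−1}` for a constant type** (`g = j + 2`), for every polarised torus of that type (the identity does not
mention the presentation; g41-#2 proved it on a symplectic one). [cite: Lange2023AbelianVarietiesComplex, §2.5.3 Thm. 2.5.16 and Cor. 2.5.17 (PDF p. 135); §1.5.1 (PDF p. 51)] -/
theorem IsPolarizationType.wedge_inv_smul_ofRealForm_eq_nsmul_of_forall_eq (hd : IsPolarizationType Φ η d) (hη : IsRiemannForm Φ η)
    (hle : j ≤ j + 2) {γ : E [⋀^Fin (2 * j)]→L[ℝ] ℂ}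
    (hγ : wedgePow (ofRealForm η) j = ((j.factorial * ∏ i : Fin j, d (Fin.castLE hle i) : ℕ) : ℂ) • γ) (hd₀ : ∀ i, d i = d 0)
    (hle₁ : j + 1 ≤ j + 2) {m : E [⋀^Fin (2 * j + 2)]→L[ℝ] ℂ}
    (hm : wedgePow (ofRealForm η) (j + 1) = (((j + 1).factorial * ∏ i : Fin (j + 1), d (Fin.castLE hle₁ i) : ℕ) : ℂ) • m) :
    γ.wedge ((((d 0 : ℕ) : ℂ))⁻¹ • ofRealForm η) = (j + 1) • m := by
  obtain ⟨Φ', hΛ, hs⟩ := hd.exists_isSymplecticEnum Φ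
  exact hs.wedge_inv_smul_ofRealForm_eq_nsmul_of_forall_eq Φ' (hη.of_range_latticeVec_subset hΛ.le) hle hγ hd₀ hle₁ hm

/-- **`⟨θ/d₁, γ_{g−2} ∧ x⟩ = (g−1) · ⟨x, γ_{g−1}⟩` for a constant type** (`g = j + 2`), any presentation and orientation.
[cite: Lange2023AbelianVarietiesComplex, §2.5.3 Thm. 2.5.16 and Cor. 2.5.17 (PDF p. 135); §6.2.4 (PDF p. 310); §1.5.1 (PDF p. 51)] [cite: WarnerGTM94, 2.6] -/
theorem IsPolarizationType.poincarePairing_inv_smul_ofRealForm_wedge_of_forall_eq (hd : IsPolarizationType Φ η d)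
    (hη : IsRiemannForm Φ η) (hle : j ≤ j + 2) {γ : E [⋀^Fin (2 * j)]→L[ℝ] ℂ}
    (hγ : wedgePow (ofRealForm η) j = ((j.factorial * ∏ i : Fin j, d (Fin.castLE hle i) : ℕ) : ℂ) • γ) (hd₀ : ∀ i, d i = d 0)
    (hle₁ : j + 1 ≤ j + 2) {m : E [⋀^Fin (2 * j + 2)]→L[ℝ] ℂ}
    (hm : wedgePow (ofRealForm η) (j + 1) = (((j + 1).factorial * ∏ i : Fin (j + 1), d (Fin.castLE hle₁ i) : ℕ) : ℂ) • m)
    (e : Fin n ≃ ι) (hn : 2 + (2 * j + 2) = n) (x : E [⋀^Fin 2]→L[ℝ] ℂ) :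
    poincarePairing Φ e hn ((((d 0 : ℕ) : ℂ))⁻¹ • ofRealForm η) (γ.wedge x) = (j + 1) • poincarePairing Φ e hn x m := by
  rw [poincarePairing_wedge_comm_of_two, hd.wedge_inv_smul_ofRealForm_eq_nsmul_of_forall_eq hη hle hγ hd₀ hle₁ hm, map_nsmul]

/-- **Constant type, `p` prime, `p ∣ g − 1`, ANY presentation: the image of `γ_{g−2} ∪ (−)` on `H²(X, ℤ/p)` is the annihilator of the
polarisation** (`g = j + 2`): `γ_{g−2} ∧ H²(X, ℤ) + p·H^{2g−2}(X, ℤ) = {z ∈ H^{2g−2}(X, ℤ) : p ∣ ⟨θ/d₁, z⟩_e}` for every orientation `e`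
(symplectic presentation: g41-#3; `H•(X, ℤ)` is lattice-only and `p ∣ ⟨θ/d₁, z⟩` is insensitive to the sign relating the pairings).
[cite: Lange2023AbelianVarietiesComplex, §6.2.4 (PDF p. 310); §5.4.1 Thm. 5.4.1 and (5.22) (PDF p. 275); §2.5.3 Cor. 2.5.17 (PDF p. 135); §1.5.1 (PDF p. 51); §2.1.1] [cite: VoisinHodgeI2002, §6.3.2; §7.1.2 (PDF p. 134 L31)] [cite: BenoistDebarre2023SmoothSubvarietiesJacobians, §1 (p. 3)] -/
theorem IsPolarizationType.map_wedge_integralForms_two_sup_map_nsmul_eq_inf_comap_of_forall_eq (hd : IsPolarizationType Φ η d)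
    (hη : IsRiemannForm Φ η) (hle : j ≤ j + 2) {γ : E [⋀^Fin (2 * j)]→L[ℝ] ℂ}
    (hγ : wedgePow (ofRealForm η) j = ((j.factorial * ∏ i : Fin j, d (Fin.castLE hle i) : ℕ) : ℂ) • γ) (hd₀ : ∀ i, d i = d 0)
    {p : ℕ} (hp : p.Prime) (hpj : p ∣ j + 1) (e : Fin n ≃ ι) (hn : 2 + (2 * j + 2) = n) :
    (integralForms Φ 2).map (AddMonoidHom.mk' (fun x : E [⋀^Fin 2]→L[ℝ] ℂ ↦ γ.wedge x) (ContinuousAlternatingMap.wedge_add_right _)) ⊔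
        (integralForms Φ (2 * j + 2)).map (nsmulAddMonoidHom p) =
      integralForms Φ (2 * j + 2) ⊓ (AddSubgroup.zmultiples (p : ℂ)).comap
        (poincarePairing Φ e hn ((((d 0 : ℕ) : ℂ))⁻¹ • ofRealForm η)).toAddMonoidHom := by
  obtain ⟨Φ', hΛ, hs⟩ := hd.exists_isSymplecticEnum Φ
  have hη' : IsRiemannForm Φ' η := hη.of_range_latticeVec_subset hΛ.le
  have hn' : n = 2 * (j + 2) := by omega
  set e' : Fin n ≃ Fin (j + 2) ⊕ Fin (j + 2) := (finCongr hn').trans (ilvEnum (Equiv.refl _)) with he'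
  have h := hs.map_wedge_integralForms_two_sup_map_nsmul_eq_inf_comap_of_forall_eq Φ' hη' hle hγ hd₀ hp hpj e' hn
  rw [integralForms_eq_of_range_latticeVec_eq hΛ 2, integralForms_eq_of_range_latticeVec_eq hΛ (2 * j + 2),
    comap_poincarePairing_eq_of_range_latticeVec_eq Φ Φ' hΛ e e' hn] at h
  exact h

/-- **Membership form, any presentation** (constant type, `p` prime, `p ∣ g − 1`, `g = j + 2`): `z ∈ H^{2g−2}(X, ℤ)` is
`γ_{g−2} ∧ x + p·y` with `x ∈ H²(X, ℤ)`, `y ∈ H^{2g−2}(X, ℤ)` iff `p ∣ ⟨θ/d₁, z⟩_e`. [cite: Lange2023AbelianVarietiesComplex, §6.2.4 (PDF p. 310); §5.4.1 (5.22) (PDF p. 275); §1.5.1 (PDF p. 51); §2.1.1] [cite: VoisinHodgeI2002, §7.1.2 (PDF p. 134 L31)] -/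
theorem IsPolarizationType.mem_map_wedge_integralForms_two_sup_map_nsmul_iff_of_forall_eq (hd : IsPolarizationType Φ η d)
    (hη : IsRiemannForm Φ η) (hle : j ≤ j + 2) {γ : E [⋀^Fin (2 * j)]→L[ℝ] ℂ}
    (hγ : wedgePow (ofRealForm η) j = ((j.factorial * ∏ i : Fin j, d (Fin.castLE hle i) : ℕ) : ℂ) • γ) (hd₀ : ∀ i, d i = d 0)
    {p : ℕ} (hp : p.Prime) (hpj : p ∣ j + 1) (e : Fin n ≃ ι) (hn : 2 + (2 * j + 2) = n) {z : E [⋀^Fin (2 * j + 2)]→L[ℝ] ℂ}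
    (hz : z ∈ integralForms Φ (2 * j + 2)) :
    z ∈ (integralForms Φ 2).map (AddMonoidHom.mk' (fun x : E [⋀^Fin 2]→L[ℝ] ℂ ↦ γ.wedge x) (ContinuousAlternatingMap.wedge_add_right _)) ⊔
        (integralForms Φ (2 * j + 2)).map (nsmulAddMonoidHom p) ↔
      ∃ c : ℤ, poincarePairing Φ e hn ((((d 0 : ℕ) : ℂ))⁻¹ • ofRealForm η) z = c * p := by
  rw [hd.map_wedge_integralForms_two_sup_map_nsmul_eq_inf_comap_of_forall_eq hη hle hγ hd₀ hp hpj e hn, AddSubgroup.mem_inf,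
    AddSubgroup.mem_comap, LinearMap.toAddMonoidHom_coe, AddSubgroup.mem_zmultiples_iff]
  simp only [zsmul_eq_mul, eq_comm]
  exact ⟨fun h1 ↦ h1.2, fun h1 ↦ ⟨hz, h1⟩⟩

/-- **Existence form, any presentation** (constant type, `p ∣ g − 1`): the integral minimal class `γ_{g−2}` exists and the image of
`γ_{g−2} ∪ (−)` modulo `p` is the annihilator of `θ/d₁`. [cite: Lange2023AbelianVarietiesComplex, §2.5.3 Thm. 2.5.16 and Cor. 2.5.17 (PDF p. 135); §5.4.1 (5.22) (PDF p. 275); §6.2.4 (PDF p. 310); §2.1.1] [cite: BenoistDebarre2023SmoothSubvarietiesJacobians, §1 (p. 3)] -/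
theorem IsPolarizationType.exists_minimalClass_map_wedge_integralForms_two_sup_map_nsmul_eq_inf_comap (hd : IsPolarizationType Φ η d)
    (hη : IsRiemannForm Φ η) (hle : j ≤ j + 2) (hd₀ : ∀ i, d i = d 0) {p : ℕ} (hp : p.Prime) (hpj : p ∣ j + 1)
    (e : Fin n ≃ ι) (hn : 2 + (2 * j + 2) = n) :
    ∃ γ ∈ integralForms Φ (2 * j), wedgePow (ofRealForm η) j = ((j.factorial * ∏ i : Fin j, d (Fin.castLE hle i) : ℕ) : ℂ) • γ ∧
      (integralForms Φ 2).map (AddMonoidHom.mk' (fun x : E [⋀^Fin 2]→L[ℝ] ℂ ↦ γ.wedge x) (ContinuousAlternatingMap.wedge_add_right _)) ⊔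
          (integralForms Φ (2 * j + 2)).map (nsmulAddMonoidHom p) =
        integralForms Φ (2 * j + 2) ⊓ (AddSubgroup.zmultiples (p : ℂ)).comap
          (poincarePairing Φ e hn ((((d 0 : ℕ) : ℂ))⁻¹ • ofRealForm η)).toAddMonoidHom := by
  obtain ⟨γ, hγZ, hγ⟩ := hd.exists_mem_integralForms_wedgePow_eq_content_smul hle
  exact ⟨γ, hγZ, hγ, hd.map_wedge_integralForms_two_sup_map_nsmul_eq_inf_comap_of_forall_eq hη hle hγ hd₀ hp hpj e hn⟩

end ModPrimeImage

end Literature.Geometry.Kaehler.ComplexTorus
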